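import Mathlib
import HarnessLib
import HarnessLib.Audit
import Summits.FinalStateConjecture.Statement
import Literature.Geometry.Lorentzian.StationaryFinalStateDecomposition
import Literature.Geometry.Lorentzian.IPlusRegular
import Literature.Geometry.Lorentzian.LorentzianMetricProofs
import HarnessLib.Audit.Status.Attr

/-!
Route: HorizonTypeCascade

DORMANT since 2026-08-24T05:41:50Z (reconciler: no traction for 6.6 d (last activity item-evidence-added at 2026-08-17T15:18:53Z); parked, not closed — `ledger route dormant route-FinalStateConjecture-HorizonTypeCascade --off` to reacti) — unstaffed, not closed; items shared with open routes are served there. `ledger route dormant <id> --off` reactivates.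

# Route HorizonTypeCascade — settle to stationary holes, then the no-hair flow chart by horizon type
decides Kerr

It suffices to show X = D ∧ NoHair ∧ NoMulti ∧ T (lens case-cascade §3.20; CASCADE.md). D =
GenericStationarySettling: tame-generically an
admissible datum has an MGHD, and every MGHD has complete 𝓘⁺ and a STATIONARY final state
decomposition (the landed structure
`StationaryFinalStateDecomposition`, Kerr backgrounds replaced by arbitrary stationary AF black
holes read in T-adapted charts) whose holes
are I⁺-regular vacuum black holes every horizon COMPONENT of which carries a non-degenerate Killing
COLLAR (a field Killing on a
neighbourhood of the component, commuting with T, non-vanishing, tangent, κ ≠ 0 — LOCAL: the global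
extension is rigidity and stays on the
uniqueness side), charts horizon-penetrating, exhaustive (radii → ∞) and future-oriented — no Kerr,
no connectedness, no global horizon
Killing field asked of the dynamics. The enumerated case tree of stationary holes by horizon type
then decides: NoHair = SmoothNoHair
(connected type: collar ⇒ Kerr, i.e. Hawking rigidity + uniqueness without analyticity, the AIK/CC08
schema shape unfolded), NoMulti =
NoMultiHorizonEquilibrium (E_N of card no-parking-ernst-riemann-hilbert: the multi-component type is
empty), T = KerrChartTransfer
(abstract isometries ⇒ the summit's Kerr–Schild charts; card redshift-makes-the-horizon-knowable is
a line for its exhaustiveness part).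
Lean: `GenericStationarySettling ∧ SmoothNoHair ∧ NoMultiHorizonEquilibrium ∧ KerrChartTransfer`

## Assembly
Pure logic, PROVED sorry-free as `closes` (glue.lean; GlueDev.lean rc 0): tame Christodoulou
genericity is
monotone in the property (8 lines, inline); per MGHD and per hole, NoMultiHorizonEquilibrium makes
the horizon connected (the multi-component
type is empty) and SmoothNoHair turns the connected type into an (unfolded) isometry with a
sub-extremal Kerr exterior, its standing facts
`hF hP [Kerr.Facts] [HasLeviCivita]` staying universally quantified and handed on; KerrChartTransfer
rebuilds the summit decomposition with the
same charted region, so `O = exteriorOf …` and `RaysStayInClosure` transfer by rewriting.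

Rationale: WHY THIS LINE. Dafermos–Luk (arXiv:1710.01722 p. 8) present the final state conjecture as
[large-data dynamics] + [black-hole uniqueness with
analyticity replaced by smoothness], and the uniqueness side is, in print, a finite FLOW CHART by
horizon type (ChruscielCostaHeusler2012
Fig. classification, Thm 3.3, §3.4.1–3.4.3: degenerate / rigidity / many components), whose analytic
branching theorem the tree already
proves (`ChruscielCosta2008_uniqueness_holds_of`). Every stationary-limit route on this summit
(SignedCensus, BeltLiouville,
ZeroEnergyKerrOrBomb, AnalyticityInvadesErgoregion, AnalyticInheritance, LapseTrumpetKID) carries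
its dynamical leg as ONE opaque frame
`NoHairVariant → FinalStateConjecture` that silently contains censorship, settling, I⁺-regularity,
CONNECTEDNESS of the limit horizons
and the chart transfer ("N ≥ 2 equilibria not excluded by X alone", "expected to be split"); this
route IS that split: the deciding theorem
is the proved branching theorem over horizon types composed with the typed leaves, the complementary
sectors (multi-horizon equilibria,
chart transfer; degeneracy inside D) become items, and the connected sector is imported in the
prelude's schema shape (collar dress,
conclusion unfolded) rather than re-invented. Imported areas: stationary black-hole
uniqueness theory (Lorentzian geometry, harmonic maps / integrable Ernst for E_N), causal theory for
T; no new analytic mechanism — the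
lens's value is the fleet-native case tree with an honest intermediate object. Negatives index: one
unrelated entry.

RANKED CRUXES. #2 GenericStationarySettling (crux) — tame-Christodoulou-generically (m = 1, one
fixed end) an admissible datum has an MGHD and every MGHD has complete 𝓘⁺ and an `N`-hole
`StationaryFinalStateDecomposition` in `C²` of `O = exteriorOf 𝒟 d.charted` with I⁺-regular, vacuum
holes, 𝓔⁺ ≠ ∅, every component of 𝓔⁺ carrying a non-degenerate Killing COLLAR (local), adapted
charts immersive and horizon-penetrating, `RaysStayInClosure`, exhaustive charts with radii → ∞,
future-oriented chart times (CASCADE.md node 1; the honest dynamical front end shared in content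
with every stationary-limit frame). [difficulty: open-problem] (why it might fail: carries WCC +
large-data asymptotic stationarity; refuted by a tame-generic datum radiating forever without
ω-limit, or settling to a hole with a DEGENERATE component generically (third law as genericity;
extremal holes do form, arXiv:2211.15742), or to a non-I⁺-regular limit.) [DafermosLuk2017,
Christodoulou1999, ChruscielCosta2008, arXiv:2211.15742, KehleUnger2024, Hintz2026,
arXiv:2104.08222]
#3 KerrChartTransfer (crux) — for a stationary final state decomposition `d` of `(𝓢, O)` in `C²`
whose holes are I⁺-regular vacuum with non-degenerate Killing collars and whose docs are isometric
to sub-extremal Kerr exteriors (the pointwise-unfolded `IsIsometricToKerrExterior`, no `hres`), with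
immersive horizon-penetrating adapted charts, exhaustive charts (radii → ∞) and future-oriented
chart times, there is a summit `FinalStateDecomposition 𝓢 O 2` with `Kerr.IsSubextremal` parameters,
the SAME charted region, `HasExhaustiveCharts` (honest radii) and `IsFutureOriented` (CASCADE.md
node 4; the 'genuine lemma, route business' of StationaryFinalStateDecomposition.lean). [difficulty:
L] (why it might fail: the abstract isometry doc → {r > r₊} may reverse time orientation and is not
known C³ up to 𝓗⁺; if boundary regularity fails, C² convergence on near-zone slabs reaching r → r₊
does not survive re-adaptation, and the exhaustion clause must be re-derived on Kerr–Schild slabs.)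
[ChruscielCosta2008, arXiv:0811.0354, arXiv:2104.08222, RaczWald1996, DafermosLuk2017]
#4 NoMultiHorizonEquilibrium (crux) — an I⁺-regular, vacuum, stationary asymptotically flat black
hole (𝓔⁺ ≠ ∅) every connected component of whose future event horizon carries a non-degenerate
Killing collar has CONNECTED 𝓔⁺ — no stationary vacuum multi-black-hole equilibrium (E_N of card
no-parking-ernst-riemann-hilbert, smooth I⁺-regular category; CASCADE.md node 3). [difficulty:
open-problem] (why it might fail: only n = 2 is excluded in print (I⁺-regular two-Kerr,
ChruscielCostaHeusler2012 Thm 3.6); n ≥ 3 co-axial Weinstein / multi-Kerr–NUT equilibria are "widely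
open", and without analyticity the rotating multi-component case needs rigidity first.)
[arXiv:0905.4179, arXiv:1105.5830, arXiv:1111.1448, ChruscielCostaHeusler2012, Weinstein1990,
arXiv:2212.14826, arXiv:0811.1727]
#5 SmoothNoHair (crux) — smooth no-hair for the connected type: every I⁺-regular vacuum stationary
AF black hole with CONNECTED horizon carrying a non-degenerate Killing collar (K Killing on an open
U ⊇ 𝓔⁺, [T,K] = 0, K ≠ 0 and tangent on 𝓔⁺, ∇_K K = κK, κ ≠ 0) has doc isometric to a sub-extremal
Kerr exterior (conclusion = `IsIsometricToKerrExterior` unfolded pointwise without the bookkeeping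
fact `hres`, SignedCensus rev-3 pattern) — Hawking rigidity from the collar PLUS uniqueness, the
shape of the prelude's AIK/CC08 schema with the global horizon Killing field weakened to a collar
(CASCADE.md node 2; the sector of SignedCensus / BeltLiouville / ZeroEnergyKerrOrBomb /
AnalyticityInvadesErgoregion; deliberately ranked last). [difficulty: open-problem] (why it might
fail: = rigidity without analyticity (ChruscielCostaHeusler2012 §3.4.2) + uniqueness: a smooth
non-Kerr I⁺-regular stationary vacuum hole with a Killing collar refutes it; Ionescu–Klainerman
local hair (arXiv:1108.3575 Thm 1.3) shows the collar field need not extend.)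
[AlexakisIonescuKlainerman2009, AlexakisIonescuKlainerman2014, IonescuKlainerman2012,
ChruscielCosta2008, ChruscielCostaHeusler2012, arXiv:1501.01587]
#9 NonRotatingConnectedIsKerr (support) — leaf 2a (ROUTINE): I⁺-regular vacuum, connected horizon
with non-degenerate Killing collar on which T is null ⇒ doc ≅ Schwarzschild ⊂ Kerr; from the facts
`SudarskyWald1993_staticity`, `ChruscielGalloway2010_docStaticUniqueness`, the tree theorem
`IsIsometricToSchwarzschildExterior.isIsometricToKerrExterior` (unfolded), and the smooth collar
version of `ChruscielCosta2008_nonRotating_horizonKilling` (cite fact wanted: CC08 §7.2 ¶1 — null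
tangent vectors to 𝓔⁺ are proportional, zeroth law, completeness of T-orbits — is smooth-category).
[difficulty: M] [SudarskyWald1993, ChruscielGalloway2010, ChruscielCosta2008]
#9 SmoothHawkingRigidity (support) — leaf 2b-rigidity (GENUINE, filed as support under
SmoothNoHair): I⁺-regular vacuum, connected horizon with a non-degenerate Killing collar, T
somewhere non-null on 𝓔⁺ ⇒ a complete axisymmetric Killing field commuting with T
(`IsStationaryAxisymmetric`) — Hawking's rigidity without analyticity from the collar (the collar
itself being what AIK local rigidity / Petersen–Rácz supply), the clean form of BeltLiouville /
ZeroEnergyKerrOrBomb / AnalyticityInvadesErgoregion targets. [difficulty: open-problem]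
[AlexakisIonescuKlainerman2009, IonescuKlainerman2012, ChruscielCosta2008, arXiv:1501.01587]
#9 StaticMultiHorizonConnected (support) — leaf 3a (ROUTINE from literature): I⁺-regular vacuum, 𝓔⁺
≠ ∅ with non-degenerate Killing collars, T null on ALL of 𝓔⁺ ⇒ 𝓔⁺ connected (per-component
Sudarsky–Wald staticity ⇒ static doc ⇒ Schwarzschild ⇒ one component; Bunting–Masood-ul-Alam 1987,
ChruscielCostaHeusler2012 p. 13); in-tree needs the per-component-κ variant of
`SudarskyWald1993_staticity` (cite fact wanted) and 'doc ≅ Schwarzschild exterior ⇒ 𝓔⁺ connected'.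
[difficulty: M] [doi:10.1007/BF00770326, SudarskyWald1993, ChruscielGalloway2010,
ChruscielCostaHeusler2012]
#9 NoHairOfCases (support) — the printed branching theorem one level down (CC08 §7, smooth dress):
NonRotatingConnectedIsKerr → SmoothHawkingRigidity → (CCH12 Thm 3.2 in collar dress: I⁺-regular,
connected horizon with non-degenerate Killing collar, stationary-axisymmetric, vacuum ⇒ Kerr — the
printed theorem needs only MEAN non-degeneracy; inlined as a hypothesis so no undischarged fact
enters the cone) → SmoothNoHair, by cases on `∃ p ∈ 𝓔⁺, g(T,T) ≠ 0` (proved in Sketch.lean,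
`noHairOfCases_proof`). [difficulty: provable-now] [ChruscielCosta2008, ChruscielCostaHeusler2012]
#9 NoMultiOfCases (support) — the same dichotomy for the multi-component type:
StaticMultiHorizonConnected → (rotating multi-horizon case ⇒ connected) → NoMultiHorizonEquilibrium
(proved in Sketch.lean, `noMultiOfCases_proof`); isolates n ≥ 3 rotating equilibria as the genuine
residue. [difficulty: provable-now] [ChruscielCostaHeusler2012, arXiv:0905.4179]

TWO-LAYER PLAN. Foreseen glued splits (each already proved as a BC3 birth skeleton, filed only when
a crux moves): GenericStationarySettling ⇐
SettlesIfCensored → GenericCensorshipThirdLaw → D; SmoothNoHair ⇐ NonRotatingConnectedIsKerr →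
SmoothHawkingRigidity → (CCH12 Thm 3.2 fact)
→ SmoothNoHair (= NoHairOfCases); NoMultiHorizonEquilibrium ⇐ StaticMultiHorizonConnected →
RotatingMultiHorizonConnected → NoMulti;
KerrChartTransfer ⇐ KerrReadaptation → RebuildDecomposition → T.

KILL CRITERIA. A smooth non-Kerr I⁺-regular stationary vacuum hole (¬SmoothNoHair) or a regular n ≥
3 vacuum equilibrium (¬NoMultiHorizonEquilibrium)
refutes the corresponding leaf AND — since such an object would be a candidate end state — the
summit's Kerr form itself: close
`refuted:<Decl>` and hand the witness to the negation side. ¬KerrChartTransfer by a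
boundary-regularity witness ⇒ pivot: restate D with
the re-adaptation datum built in (D absorbs 4a). ¬GenericStationarySettling by a generic degenerate
end state ⇒ the summit as typed
(sub-extremal, ruling F4) is false; by eternal radiation ⇒ pivot to the ω-limit routes' weaker
settling. SmoothNoHair proved elsewhere
(SignedCensus/BeltLiouville lines) closes rank 5 for free. If SmoothNoHair is refuted by an exotic
hole that is dynamically UNSTABLE (so the summit survives), pivot the connected leaf to
ZeroEnergyKerrOrBomb's `KerrOrBombModT` (only Killing-mode-stable holes need be Kerr) and strengthen
D by mode-stability of limits — the same cut, one hypothesis moved across the seam.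

NOT DECOMPOSED YET. D is deliberately ONE item (two genericity statements do not compose; its BC3
split is along censorship, not along ∧); the degenerate
sub-tree (near-horizon classification, extremal Kerr uniqueness, third-law transversality) lives
inside D; the per-component-κ
Sudarsky–Wald and smooth CC08 §7.2 ¶1 cite facts are wanted, not filed as items; n = 2 vs n ≥ 3
inside NoMulti is a layer-2 split.

CHEAPEST FALSIFIER. Lookup + typing audit, both run: (i) is E_N or collar-no-hair already a
theorem/item? — `lean search` / BC4 `exact?` over all 56 Theses:
no item; CCH12 p. 14: "The case of more than two horizons is widely open"; (ii) BC2 probes `C →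
FinalStateConjecture` for all four cruxes
FAIL (heartbeat timeout / unsolved goal), `closes` elaborates with all four binders used. Next
cheapest for a refuter: exhibit a
time-orientation-REVERSING isometry obstruction to KerrChartTransfer as typed (the statement
quantifies the hole's own time orientation in
the future-orientation clause precisely to block it).

NUMBERS. Census (CASCADE.md): 16 leaves = 8 genuine (4 cruxed: D, T, NoMulti, SmoothNoHair; 4 inside
items) + 8 routine (3 typed as supports with 4 cite
facts filed, 5 recorded inside D/NoMulti for their provers) + 0 compute; items at open: 10 (4
cruxes, 5 supports, 1 assembly). Known sectors: n = 2 equilibria excluded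
(CCH12 Thm 3.6); Kerr stability |a| ≪ M (KlainermanSzeftel2023, GiorgiKlainermanSzeftel2022), a = 0
(DafermosHolzegelRodnianskiTaylor2021),
full |a| < M (Hintz2026, arXiv:2606.28253).

DEFINITION REQUESTS. None new: `StationaryFinalStateDecomposition`, `AdaptedChart`,
`IsIPlusRegular`, `IsStationaryAxisymmetric`, `Kerr.smoothMetric/exterior/docOpens` all exist;
the Killing-collar clause is inlined (pattern of BeltLiouville). Cite facts FILED (`--kind cite`,
2026-08-17): smooth CC08 §7.2 ¶1 horizon-Killing step
(collar dress); per-component Sudarsky–Wald staticity; Bunting–Masood-ul-Alam multi-component static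
uniqueness; CCH12 Thm 3.6 (two-Kerr).

Novelty: Searches (2026-08-17): `lit search --hybrid "Nonlinear stability of subextremal Kerr black holes"`
(Hintz2026 held); `lit search --hybrid
"stationary two black hole configurations nonexistence double Kerr"` (arXiv:0905.4179 held); `lit
read arXiv:1205.6112 --grep multi|components`
(Thm 3.6, §3.4, pp. 12–14 quoted); `lit read arXiv:1710.01722 --pages 7-9` (p. 8 quoted); `lit
frontier FinalStateConjecture --since 2022`
(30 rows; arXiv:2601.01517 multi-BH Cauchy data, none on multi-horizon uniqueness); `lit galaxy
search "final state conjecture" --star all`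
(6 rows, none relevant); `lit galaxy search "uniqueness of stationary black holes without
analyticity" --star all` (0); `lean search
AlexakisIonescuKlainermanRigidity|IsIPlusRegularNonDegenerate` over Theses (no item); Ideas/*.md (15
open cards read: no-parking, redshift,
third-law, horizon-first are leaves/lines of this tree, none is a route).
Nearest prior art found: DafermosLuk2017 p. 8 (dynamics + smooth uniqueness ⇒ final state) and
ChruscielCostaHeusler2012 (the uniqueness
flow chart); on the ledger, SignedCensus.NoHairToFinalState / BeltLiouville.FinalStateFromRigidity /
ZeroEnergyKerrOrBomb.FinalStateFromKerrOrBomb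
(opaque frames) and AnalyticInheritance (U + N split, analytic category, blocked).
Delta: the first deciding theorem on this summit whose dynamical hypothesis has an honest stationary
conclusion (typed over the landed
`StationaryFinalStateDecomposition`) and whose stationary side is the COMPLETE horizon-typ  [refs: 0905.4179, 1205.6112, 1710.01722, 2601.01517, Hintz2026, DafermosLuk2017, ChruscielCostaHeusler2012]

Barriers (technique_class: stationary-limit, black-hole-uniqueness, case-cascade): - technique_class: stationary-limit, black-hole-uniqueness, case-cascade
- Literature.Barriers.FinalStateConjecture.IonescuKlainermanNonExtension: bites the leaf
SmoothNoHair (and the rotating branch of NoMulti) — it does not evade it; the bet is that this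
sector is carried by the lines already staffed on it (BeltLiouville's zero-frequency Liouville,
ZeroEnergyKerrOrBomb, SignedCensus' census, hair-is-flat), which the route imports in schema shape
(collar dress) instead of re-deriving; E_N's own attack (card no-parking) works inside the
stationary-axisymmetric class where no Killing extension is needed.
- Literature.Barriers.FinalStateConjecture.AretakisInstability: degenerate horizons are exactly what
D's genericity clause must exclude; the instability is the expected MECHANISM of non-genericity
(leaf 1f), not an obstruction to the line; the uniqueness leaves assume non-degeneracy throughout.
- Literature.Barriers.FinalStateConjecture.SlowlyRotatingKerrFrontier: D asserts settling for large
data; the near-Kerr sector is now in print for all |a| < M (Hintz2026), so the frontier no longer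
bounds the small-data leaf; for large data it does not apply (no perturbative hypothesis).
- Literature.Barriers.FinalStateConjecture.KehrbergerLogarithmicAsymptotics: D uses the summit's
intrinsic sojourn form of complete 𝓘⁺ and C² chart convergence without rates or conformal smoothness
— outside the barrier's class.
- Literature.Barriers.FinalStateConjecture.SbierskiTrappingObstruction: con

History (route lifecycle, newest last):
- 2026-08-17T03:00:49Z · rev 1: restated SmoothHawkingRigidity (stmt-FinalStateConjecture-18560) — route-repair (cone): inline abbrev StationaryAFBlackHole.IsStationaryAxisymmetric (body over Spacetime.IsAxisymmetricKilling, Stationary.lean) in SmoothHawkingR (planner-rrepair-FinalStateConjecture-HorizonTy-cfa5167c-0)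
- 2026-08-17T03:01:58Z · rev 2: restated NoHairOfCases (stmt-FinalStateConjecture-18562) — route-repair (cone) step 2/3: inline abbrev IsStationaryAxisymmetric in NoHairOfCases (reducibly defeq to rev 0) and re-render it AFTER the restated SmoothHawki (planner-rrepair-FinalStateConjecture-HorizonTy-cfa5167c-0)
- 2026-08-24T05:41:50Z · DORMANT — reconciler: no traction for 6.6 d (last activity item-evidence-added at 2026-08-17T15:18:53Z); parked, not closed — `ledger route dormant route-FinalStateConjec (operator:999:3420769)

sub-problem: FinalStateConjecture · status: dormant · opened planner-plan-lens3-FinalStateConjecture-cascade-g2-0 2026-08-17T02:45:32Z · rev 4 · ledger route-FinalStateConjecture-HorizonTypeCascade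
GENERATED by the gate from the ledger (D-0016/17). Provers cite these decls: `theorem foo : Summit.FinalStateConjecture.FinalStateConjecture.Theses.HorizonTypeCascade.<Decl> := …` in Summits/FinalStateConjecture/FinalStateConjecture/Theorems/<Name>.lean.
-/

namespace Summit.FinalStateConjecture.FinalStateConjecture.Theses.HorizonTypeCascade

open scoped BigOperators Topology Manifold Classical MeasureTheory ProbabilityTheory Matrix InnerProductSpace ComplexConjugate ContinuousMap
open Filter Set Function TopologicalSpace MeasureTheory

attribute [summit_statement] _root_.FinalStateConjecture

/-- item stmt-FinalStateConjecture-18555 · crux · rank 2 · open · by planner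
why it might fail: carries WCC + large-data asymptotic stationarity; refuted by a tame-generic datum radiating forever without ω-limit, or settling to a hole with a DEGENERATE component generically (third law as genericity; extremal holes do form, arXiv:2211.15742), or to a non-I⁺-regular limit.
sources: DafermosLuk2017, Christodoulou1999, ChruscielCosta2008, arXiv:2211.15742, KehleUnger2024, Hintz2026
[crux] tame-Christodoulou-generically (m = 1, one fixed end) an admissible datum has an MGHD and
every MGHD has complete 𝓘⁺ and an `N`-hole `StationaryFinalStateDecomposition` in `C²` of `O =
exteriorOf 𝒟 d.charted` with I⁺-regular, vacuum holes, 𝓔⁺ ≠ ∅, every component of 𝓔⁺ carrying a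
non-degenerate Killing COLLAR (local), adapted charts immersive and horizon-penetrating,
`RaysStayInClosure`, exhaustive charts with radii → ∞, future-oriented chart times (CASCADE.md node
1; the honest dynamical front end shared in content with every stationary-limit frame). [difficulty:
open-problem] -/
@[route_item "route-FinalStateConjecture-HorizonTypeCascade", crux]
def GenericStationarySettling : Prop :=
  ∀ (X : Type) [TopologicalSpace X] [ChartedSpace Literature.Geometry.Lorentzian.E3 X] [IsManifold (𝓡 3) ((⊤ : ℕ∞) : WithTop ℕ∞) X] [T2Space X] [SecondCountableTopology X] [ConnectedSpace X], Literature.Geometry.Lorentzian.InitialDataSet.IsTameChristodoulouGeneric (Literature.Geometry.Lorentzian.admissibleVacuumData X) (fun D ↦ (∃ 𝒟 : Literature.Geometry.Lorentzian.VacuumCauchyDevelopment D, 𝒟.IsMaximal) ∧ ∀ 𝒟 : Literature.Geometry.Lorentzian.VacuumCauchyDevelopment D, 𝒟.IsMaximal → (Summit.FinalStateConjecture.HasCompleteNullInfinity 𝒟.toCauchyDevelopment ∧ ∃ (O : Set 𝒟.carrier) (d : Literature.Geometry.Lorentzian.StationaryFinalStateDecomposition 𝒟.toSpacetime O 2), (∀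 i, (∀ [(d.hole i).metric.HasLeviCivita], (d.hole i).IsIPlusRegular ∧ (d.hole i).metric.toPseudoRiemannianMetric.IsRicciFlat ∧ (d.hole i).horizon.Nonempty ∧ (∀ p ∈ (d.hole i).horizon, ∃ (U : Set (d.hole i).carrier) (K : Π x : (d.hole i).carrier, TangentSpace (𝓡 4) x) (κ : ℝ), IsOpen U ∧ connectedComponentIn (d.hole i).horizon p ⊆ U ∧ ContMDiffOn (𝓡 4) ((𝓡 4).prod 𝓘(ℝ, Literature.Geometry.Lorentzian.E4)) ((⊤ : ℕ∞) : WithTop ℕ∞) (fun x ↦ (Bundle.TotalSpace.mk' Literature.Geometry.Lorentzian.E4 x (K x) : TangentBundle (𝓡 4) (d.hole i).carrier)) U ∧ (∀ x ∈ U, ∀ v w : TangentSpace (𝓡 4) x, (d.hole i).metric.val x ((d.hole i).metric.leviCivita K x v) w + (d.hole i).metric.val x v ((d.hole i).metric.leviCivita K x w) = 0) ∧ (∀ x ∈ U, VectorField.mlieBracket (𝓡 4) (d.hole i).killing K x = 0) ∧ (∀ q ∈ connectedComponentIn (d.hole i).horizon p, K q ≠ 0) ∧ (∀ γ : ℝ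 → (d.hole i).carrier, IsMIntegralCurve γ K → γ 0 ∈ connectedComponentIn (d.hole i).horizon p → ∀ t, γ t ∈ (d.hole i).horizon) ∧ κ ≠ 0 ∧ ∀ q ∈ connectedComponentIn (d.hole i).horizon p, (d.hole i).metric.leviCivita K q (K q) = κ • K q))) ∧ (∀ i, (∀ x, Function.Injective (mfderiv 𝓘(ℝ, Literature.Geometry.Lorentzian.E4) (𝓡 4) (d.adapted i).toFun x)) ∧ (d.hole i).horizon ⊆ Set.range (d.adapted i).toFun) ∧ O = Summit.FinalStateConjecture.exteriorOf 𝒟.toCauchyDevelopment d.charted ∧ Summit.FinalStateConjecture.RaysStayInClosure 𝒟.toCauchyDevelopment O ∧ (∃ R : Fin d.N → ℝ → ℝ, (∀ i, Filter.Tendsto (R i) Filter.atTop Filter.atTop) ∧ (∀ i, Filter.Tendsto (fun τ ↦ 𝒟.toSpacetime.truncDeviationCk (d.background i) (d.toOver.chart i) 2 (R i τ) τ) Filter.atTop (nhds 0)) ∧ ∀ τ₁ : ℝ, d.toOver.τ₀ < τ₁ → O \ d.toOver.certifiedLate R τ₁ ⊆ 𝒟.toSpacetime.metric.causalPast 𝒟.toSpacetime.timeOrientation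 (d.toOver.certifiedSlab R τ₁)) ∧ ((∀ i, Summit.FinalStateConjecture.IsOrthochronous (d.motion i).1) ∧ (∀ i (ρ : ℝ), ∀ᶠ τ in Filter.atTop, ∀ x ∈ (d.background i).truncTimeSlab ρ τ, ∀ v : Literature.Geometry.Lorentzian.E4, mfderiv 𝓘(ℝ, Literature.Geometry.Lorentzian.E4) (𝓡 4) (d.adapted i).toFun ⟨Literature.Geometry.Lorentzian.poincareInv (d.motion i).1 (d.motion i).2 x.1, x.2⟩ v = (d.hole i).timeOrientation.vectorField ((d.adapted i).toFun ⟨Literature.Geometry.Lorentzian.poincareInv (d.motion i).1 (d.motion i).2 x.1, x.2⟩) → 𝒟.toSpacetime.timeOrientation.IsFutureDirected (mfderiv 𝓘(ℝ, Literature.Geometry.Lorentzian.E4) (𝓡 4) (d.toOver.chart i) x (((d.motion i).1 : Literature.Geometry.Lorentzian.E4 ≃L[ℝ] Literature.Geometry.Lorentzian.E4) v))) ∧ ∀ᶠ τ in Filter.atTop, ∀ x ∈ (Literature.Geometry.Lorentzian.Minkowski.backgroundOn d.toOver.flatDomain).timeSlab τ, 𝒟.toSpacetime.timeOrientation.IsFutureDirected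 (mfderiv 𝓘(ℝ, Literature.Geometry.Lorentzian.E4) (𝓡 4) d.toOver.flatChart x (Literature.Geometry.Lorentzian.E4.basisVector 0))))) 1

/-- item stmt-FinalStateConjecture-18556 · crux · rank 3 · open · by planner
why it might fail: the abstract isometry doc → {r > r₊} may reverse time orientation and is not known C³ up to 𝓗⁺; if boundary regularity fails, C² convergence on near-zone slabs reaching r → r₊ does not survive re-adaptation, and the exhaustion clause must be re-derived on Kerr–Schild slabs.
sources: ChruscielCosta2008, arXiv:0811.0354, arXiv:2104.08222, RaczWald1996, DafermosLuk2017
[crux] for a stationary final state decomposition `d` of `(𝓢, O)` in `C²` whose holes are I⁺-regular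
vacuum with non-degenerate Killing collars and whose docs are isometric to sub-extremal Kerr
exteriors (the pointwise-unfolded `IsIsometricToKerrExterior`, no `hres`), with immersive
horizon-penetrating adapted charts, exhaustive charts (radii → ∞) and future-oriented chart times,
there is a summit `FinalStateDecomposition 𝓢 O 2` with `Kerr.IsSubextremal` parameters, the SAME
charted region, `HasExhaustiveCharts` (honest radii) and `IsFutureOriented` (CASCADE.md node 4; the
'genuine lemma, route business' of StationaryFinalStateDecomposition.lean). [difficulty: L] -/
@[route_item "route-FinalStateConjecture-HorizonTypeCascade", crux]
def KerrChartTransfer : Prop :=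
  ∀ (𝓢 : Literature.Geometry.Lorentzian.Spacetime.{0} 4) (O : Set 𝓢.carrier) (d : Literature.Geometry.Lorentzian.StationaryFinalStateDecomposition 𝓢 O 2), (∀ i, (∀ [(d.hole i).metric.HasLeviCivita], (d.hole i).IsIPlusRegular ∧ (d.hole i).metric.toPseudoRiemannianMetric.IsRicciFlat ∧ (d.hole i).horizon.Nonempty ∧ (∀ p ∈ (d.hole i).horizon, ∃ (U : Set (d.hole i).carrier) (K : Π x : (d.hole i).carrier, TangentSpace (𝓡 4) x) (κ : ℝ), IsOpen U ∧ connectedComponentIn (d.hole i).horizon p ⊆ U ∧ ContMDiffOn (𝓡 4) ((𝓡 4).prod 𝓘(ℝ, Literature.Geometry.Lorentzian.E4)) ((⊤ : ℕ∞) : WithTop ℕ∞) (fun x ↦ (Bundle.TotalSpace.mk' Literature.Geometry.Lorentzian.E4 x (K x) : TangentBundle (𝓡 4) (d.hole i).carrier)) U ∧ (∀ x ∈ U, ∀ v w : TangentSpace (𝓡 4) x, (d.hole i).metric.val x ((d.hole i).metric.leviCivita K x v) w + (d.hole i).metric.val x v ((d.hole i).metric.leviCivita K x w) = 0) ∧ (∀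 x ∈ U, VectorField.mlieBracket (𝓡 4) (d.hole i).killing K x = 0) ∧ (∀ q ∈ connectedComponentIn (d.hole i).horizon p, K q ≠ 0) ∧ (∀ γ : ℝ → (d.hole i).carrier, IsMIntegralCurve γ K → γ 0 ∈ connectedComponentIn (d.hole i).horizon p → ∀ t, γ t ∈ (d.hole i).horizon) ∧ κ ≠ 0 ∧ ∀ q ∈ connectedComponentIn (d.hole i).horizon p, (d.hole i).metric.leviCivita K q (K q) = κ • K q))) → (∀ i, (∀ [(d.hole i).metric.HasLeviCivita] [Literature.Geometry.Lorentzian.Kerr.Facts] (hF : (d.hole i).metric.isOpen_chronologicalFuture (d.hole i).timeOrientation) (hP : (d.hole i).metric.isOpen_chronologicalPast (d.hole i).timeOrientation), (∃ (M a : ℝ) (_ : Literature.Geometry.Lorentzian.Kerr.IsSubextremal M a) (Φ : Diffeomorph (𝓡 4) 𝓘(ℝ, Literature.Geometry.Lorentzian.E4) ((d.hole i).docOpens hF hP) (Literature.Geometry.Lorentzian.Kerr.exterior M a) ((⊤ : ℕ∞) : WithTop ℕ∞)), ∀ (y : (d.hole i).docOpens hF hP) (v w : EuclideanSpace ℝ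 (Fin 4)), (Literature.Geometry.Lorentzian.Kerr.smoothMetric M a (Literature.Geometry.Lorentzian.Kerr.rPlus M a)).val (Φ y) (mfderiv (𝓡 4) 𝓘(ℝ, Literature.Geometry.Lorentzian.E4) Φ y v) (mfderiv (𝓡 4) 𝓘(ℝ, Literature.Geometry.Lorentzian.E4) Φ y w) = (d.hole i).metric.val y.1 v w))) → (∀ i, (∀ x, Function.Injective (mfderiv 𝓘(ℝ, Literature.Geometry.Lorentzian.E4) (𝓡 4) (d.adapted i).toFun x)) ∧ (d.hole i).horizon ⊆ Set.range (d.adapted i).toFun) → (∃ R : Fin d.N → ℝ → ℝ, (∀ i, Filter.Tendsto (R i) Filter.atTop Filter.atTop) ∧ (∀ i, Filter.Tendsto (fun τ ↦ 𝓢.truncDeviationCk (d.background i) (d.toOver.chart i) 2 (R i τ) τ) Filter.atTop (nhds 0)) ∧ ∀ τ₁ : ℝ, d.toOver.τ₀ < τ₁ → O \ d.toOver.certifiedLate R τ₁ ⊆ 𝓢.metric.causalPast 𝓢.timeOrientation (d.toOver.certifiedSlab R τ₁)) → ((∀ i, Summit.FinalStateConjecture.IsOrthochronous (d.motion i).1)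 ∧ (∀ i (ρ : ℝ), ∀ᶠ τ in Filter.atTop, ∀ x ∈ (d.background i).truncTimeSlab ρ τ, ∀ v : Literature.Geometry.Lorentzian.E4, mfderiv 𝓘(ℝ, Literature.Geometry.Lorentzian.E4) (𝓡 4) (d.adapted i).toFun ⟨Literature.Geometry.Lorentzian.poincareInv (d.motion i).1 (d.motion i).2 x.1, x.2⟩ v = (d.hole i).timeOrientation.vectorField ((d.adapted i).toFun ⟨Literature.Geometry.Lorentzian.poincareInv (d.motion i).1 (d.motion i).2 x.1, x.2⟩) → 𝓢.timeOrientation.IsFutureDirected (mfderiv 𝓘(ℝ, Literature.Geometry.Lorentzian.E4) (𝓡 4) (d.toOver.chart i) x (((d.motion i).1 : Literature.Geometry.Lorentzian.E4 ≃L[ℝ] Literature.Geometry.Lorentzian.E4) v))) ∧ ∀ᶠ τ in Filter.atTop, ∀ x ∈ (Literature.Geometry.Lorentzian.Minkowski.backgroundOn d.toOver.flatDomain).timeSlab τ, 𝓢.timeOrientation.IsFutureDirected (mfderiv 𝓘(ℝ, Literature.Geometry.Lorentzian.E4) (𝓡 4) d.toOver.flatChart x (Literature.Geometry.Lorentzian.E4.basisVector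 0))) → ∃ d' : Literature.Geometry.Lorentzian.FinalStateDecomposition 𝓢 O 2, (∀ i, Literature.Geometry.Lorentzian.Kerr.IsSubextremal (d'.mass i) (d'.spin i)) ∧ d'.charted = d.charted ∧ Summit.FinalStateConjecture.HasExhaustiveCharts d' ∧ Summit.FinalStateConjecture.IsFutureOriented d'

/-- item stmt-FinalStateConjecture-18557 · crux · rank 4 · open · by planner
why it might fail: only n = 2 is excluded in print (I⁺-regular two-Kerr, ChruscielCostaHeusler2012 Thm 3.6); n ≥ 3 co-axial Weinstein / multi-Kerr–NUT equilibria are "widely open", and without analyticity the rotating multi-component case needs rigidity first.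
sources: arXiv:0905.4179, arXiv:1105.5830, arXiv:1111.1448, ChruscielCostaHeusler2012, Weinstein1990, arXiv:2212.14826
[crux] an I⁺-regular, vacuum, stationary asymptotically flat black hole (𝓔⁺ ≠ ∅) every connected
component of whose future event horizon carries a non-degenerate Killing collar has CONNECTED 𝓔⁺ —
no stationary vacuum multi-black-hole equilibrium (E_N of card no-parking-ernst-riemann-hilbert,
smooth I⁺-regular category; CASCADE.md node 3). [difficulty: open-problem] -/
@[route_item "route-FinalStateConjecture-HorizonTypeCascade", crux]
def NoMultiHorizonEquilibrium : Prop :=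
  ∀ (𝓑 : Literature.Geometry.Lorentzian.StationaryAFBlackHole.{0}) [𝓑.metric.HasLeviCivita], 𝓑.IsIPlusRegular → 𝓑.metric.toPseudoRiemannianMetric.IsRicciFlat → 𝓑.horizon.Nonempty → (∀ p ∈ 𝓑.horizon, ∃ (U : Set 𝓑.carrier) (K : Π x : 𝓑.carrier, TangentSpace (𝓡 4) x) (κ : ℝ), IsOpen U ∧ connectedComponentIn 𝓑.horizon p ⊆ U ∧ ContMDiffOn (𝓡 4) ((𝓡 4).prod 𝓘(ℝ, Literature.Geometry.Lorentzian.E4)) ((⊤ : ℕ∞) : WithTop ℕ∞) (fun x ↦ (Bundle.TotalSpace.mk' Literature.Geometry.Lorentzian.E4 x (K x) : TangentBundle (𝓡 4) 𝓑.carrier)) U ∧ (∀ x ∈ U, ∀ v w : TangentSpace (𝓡 4) x, 𝓑.metric.val x (𝓑.metric.leviCivita K x v) w + 𝓑.metric.val x v (𝓑.metric.leviCivita K x w) = 0) ∧ (∀ x ∈ U, VectorField.mlieBracket (𝓡 4) 𝓑.killing K x = 0) ∧ (∀ q ∈ connectedComponentIn 𝓑.horizon p, K q ≠ 0) ∧ (∀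 γ : ℝ → 𝓑.carrier, IsMIntegralCurve γ K → γ 0 ∈ connectedComponentIn 𝓑.horizon p → ∀ t, γ t ∈ 𝓑.horizon) ∧ κ ≠ 0 ∧ ∀ q ∈ connectedComponentIn 𝓑.horizon p, 𝓑.metric.leviCivita K q (K q) = κ • K q) → IsConnected 𝓑.horizon

/-- item stmt-FinalStateConjecture-18558 · crux · rank 5 · open · by planner
why it might fail: = rigidity without analyticity (ChruscielCostaHeusler2012 §3.4.2) + uniqueness: a smooth non-Kerr I⁺-regular stationary vacuum hole with a Killing collar refutes it; Ionescu–Klainerman local hair (arXiv:1108.3575 Thm 1.3) shows the collar field need not extend.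
sources: AlexakisIonescuKlainerman2009, AlexakisIonescuKlainerman2014, IonescuKlainerman2012, ChruscielCosta2008, ChruscielCostaHeusler2012, arXiv:1501.01587
[crux] smooth no-hair for the connected type: every I⁺-regular vacuum stationary AF black hole with
CONNECTED horizon carrying a non-degenerate Killing collar (K Killing on an open U ⊇ 𝓔⁺, [T,K] = 0,
K ≠ 0 and tangent on 𝓔⁺, ∇_K K = κK, κ ≠ 0) has doc isometric to a sub-extremal Kerr exterior
(conclusion = `IsIsometricToKerrExterior` unfolded pointwise without the bookkeeping fact `hres`,
SignedCensus rev-3 pattern) — Hawking rigidity from the collar PLUS uniqueness, the shape of the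
prelude's AIK/CC08 schema with the global horizon Killing field weakened to a collar (CASCADE.md
node 2; the sector of SignedCensus / BeltLiouville / ZeroEnergyKerrOrBomb /
AnalyticityInvadesErgoregion; deliberately ranked last). [difficulty: open-problem] -/
@[route_item "route-FinalStateConjecture-HorizonTypeCascade", crux]
def SmoothNoHair : Prop :=
  ∀ (𝓑 : Literature.Geometry.Lorentzian.StationaryAFBlackHole.{0}) [𝓑.metric.HasLeviCivita] [Literature.Geometry.Lorentzian.Kerr.Facts] (hF : 𝓑.metric.isOpen_chronologicalFuture 𝓑.timeOrientation) (hP : 𝓑.metric.isOpen_chronologicalPast 𝓑.timeOrientation), 𝓑.IsIPlusRegular → 𝓑.metric.toPseudoRiemannianMetric.IsRicciFlat → IsConnected 𝓑.horizon → (∀ p ∈ 𝓑.horizon, ∃ (U : Set 𝓑.carrier) (K : Π x : 𝓑.carrier, TangentSpace (𝓡 4) x) (κ : ℝ), IsOpen U ∧ connectedComponentIn 𝓑.horizon p ⊆ U ∧ ContMDiffOn (𝓡 4) ((𝓡 4).prod 𝓘(ℝ, Literature.Geometry.Lorentzian.E4)) ((⊤ : ℕ∞) : WithTop ℕ∞)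 (fun x ↦ (Bundle.TotalSpace.mk' Literature.Geometry.Lorentzian.E4 x (K x) : TangentBundle (𝓡 4) 𝓑.carrier)) U ∧ (∀ x ∈ U, ∀ v w : TangentSpace (𝓡 4) x, 𝓑.metric.val x (𝓑.metric.leviCivita K x v) w + 𝓑.metric.val x v (𝓑.metric.leviCivita K x w) = 0) ∧ (∀ x ∈ U, VectorField.mlieBracket (𝓡 4) 𝓑.killing K x = 0) ∧ (∀ q ∈ connectedComponentIn 𝓑.horizon p, K q ≠ 0) ∧ (∀ γ : ℝ → 𝓑.carrier, IsMIntegralCurve γ K → γ 0 ∈ connectedComponentIn 𝓑.horizon p → ∀ t, γ t ∈ 𝓑.horizon) ∧ κ ≠ 0 ∧ ∀ q ∈ connectedComponentIn 𝓑.horizon p, 𝓑.metric.leviCivita K q (K q) = κ • K q) → (∃ (M a : ℝ) (_ : Literature.Geometry.Lorentzian.Kerr.IsSubextremal M a) (Φ : Diffeomorph (𝓡 4) 𝓘(ℝ, Literature.Geometry.Lorentzian.E4) (𝓑.docOpens hF hP) (Literature.Geometry.Lorentzian.Kerr.exterior M a) ((⊤ : ℕ∞) : WithTop ℕ∞)),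 ∀ (y : 𝓑.docOpens hF hP) (v w : EuclideanSpace ℝ (Fin 4)), (Literature.Geometry.Lorentzian.Kerr.smoothMetric M a (Literature.Geometry.Lorentzian.Kerr.rPlus M a)).val (Φ y) (mfderiv (𝓡 4) 𝓘(ℝ, Literature.Geometry.Lorentzian.E4) Φ y v) (mfderiv (𝓡 4) 𝓘(ℝ, Literature.Geometry.Lorentzian.E4) Φ y w) = 𝓑.metric.val y.1 v w)

/-- item stmt-FinalStateConjecture-18559 · support · rank 9 · open · by planner
sources: SudarskyWald1993, ChruscielGalloway2010, ChruscielCosta2008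
[support] leaf 2a (ROUTINE): I⁺-regular vacuum, connected horizon with non-degenerate Killing collar
on which T is null ⇒ doc ≅ Schwarzschild ⊂ Kerr; from the facts `SudarskyWald1993_staticity`,
`ChruscielGalloway2010_docStaticUniqueness`, the tree theorem
`IsIsometricToSchwarzschildExterior.isIsometricToKerrExterior` (unfolded), and the smooth collar
version of `ChruscielCosta2008_nonRotating_horizonKilling` (cite fact wanted: CC08 §7.2 ¶1 — null
tangent vectors to 𝓔⁺ are proportional, zeroth law, completeness of T-orbits — is smooth-category).
[difficulty: M] -/
@[route_item "route-FinalStateConjecture-HorizonTypeCascade"]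
def NonRotatingConnectedIsKerr : Prop :=
  ∀ (𝓑 : Literature.Geometry.Lorentzian.StationaryAFBlackHole.{0}) [𝓑.metric.HasLeviCivita] [Literature.Geometry.Lorentzian.Kerr.Facts] (hF : 𝓑.metric.isOpen_chronologicalFuture 𝓑.timeOrientation) (hP : 𝓑.metric.isOpen_chronologicalPast 𝓑.timeOrientation), 𝓑.IsIPlusRegular → 𝓑.metric.toPseudoRiemannianMetric.IsRicciFlat → IsConnected 𝓑.horizon → (∀ p ∈ 𝓑.horizon, ∃ (U : Set 𝓑.carrier) (K : Π x : 𝓑.carrier, TangentSpace (𝓡 4) x) (κ : ℝ), IsOpen U ∧ connectedComponentIn 𝓑.horizon p ⊆ U ∧ ContMDiffOn (𝓡 4) ((𝓡 4).prod 𝓘(ℝ, Literature.Geometry.Lorentzian.E4)) ((⊤ : ℕ∞) : WithTop ℕ∞) (fun x ↦ (Bundle.TotalSpace.mk' Literature.Geometry.Lorentzian.E4 x (K x) : TangentBundle (𝓡 4) 𝓑.carrier)) U ∧ (∀ x ∈ U, ∀ v w : TangentSpace (𝓡 4) x, 𝓑.metric.val x (𝓑.metric.leviCivita K x v) w + 𝓑.metric.val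 x v (𝓑.metric.leviCivita K x w) = 0) ∧ (∀ x ∈ U, VectorField.mlieBracket (𝓡 4) 𝓑.killing K x = 0) ∧ (∀ q ∈ connectedComponentIn 𝓑.horizon p, K q ≠ 0) ∧ (∀ γ : ℝ → 𝓑.carrier, IsMIntegralCurve γ K → γ 0 ∈ connectedComponentIn 𝓑.horizon p → ∀ t, γ t ∈ 𝓑.horizon) ∧ κ ≠ 0 ∧ ∀ q ∈ connectedComponentIn 𝓑.horizon p, 𝓑.metric.leviCivita K q (K q) = κ • K q) → (∀ p ∈ 𝓑.horizon, 𝓑.metric.val p (𝓑.killing p) (𝓑.killing p) = 0) → (∃ (M a : ℝ) (_ : Literature.Geometry.Lorentzian.Kerr.IsSubextremal M a) (Φ : Diffeomorph (𝓡 4) 𝓘(ℝ, Literature.Geometry.Lorentzian.E4) (𝓑.docOpens hF hP) (Literature.Geometry.Lorentzian.Kerr.exterior M a) ((⊤ : ℕ∞) : WithTop ℕ∞)), ∀ (y : 𝓑.docOpens hF hP) (v w : EuclideanSpace ℝ (Fin 4)), (Literature.Geometry.Lorentzian.Kerr.smoothMetric M a (Literature.Geometry.Lorentzian.Kerr.rPlus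 M a)).val (Φ y) (mfderiv (𝓡 4) 𝓘(ℝ, Literature.Geometry.Lorentzian.E4) Φ y v) (mfderiv (𝓡 4) 𝓘(ℝ, Literature.Geometry.Lorentzian.E4) Φ y w) = 𝓑.metric.val y.1 v w)

/-- item stmt-FinalStateConjecture-18561 · support · rank 9 · open · by planner
sources: doi:10.1007/BF00770326, SudarskyWald1993, ChruscielGalloway2010, ChruscielCostaHeusler2012
[support] leaf 3a (ROUTINE from literature): I⁺-regular vacuum, 𝓔⁺ ≠ ∅ with non-degenerate Killing
collars, T null on ALL of 𝓔⁺ ⇒ 𝓔⁺ connected (per-component Sudarsky–Wald staticity ⇒ static doc ⇒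
Schwarzschild ⇒ one component; Bunting–Masood-ul-Alam 1987, ChruscielCostaHeusler2012 p. 13);
in-tree needs the per-component-κ variant of `SudarskyWald1993_staticity` (cite fact wanted) and
'doc ≅ Schwarzschild exterior ⇒ 𝓔⁺ connected'. [difficulty: M] -/
@[route_item "route-FinalStateConjecture-HorizonTypeCascade"]
def StaticMultiHorizonConnected : Prop :=
  ∀ (𝓑 : Literature.Geometry.Lorentzian.StationaryAFBlackHole.{0}) [𝓑.metric.HasLeviCivita], 𝓑.IsIPlusRegular → 𝓑.metric.toPseudoRiemannianMetric.IsRicciFlat → 𝓑.horizon.Nonempty → (∀ p ∈ 𝓑.horizon, ∃ (U : Set 𝓑.carrier) (K : Π x : 𝓑.carrier, TangentSpace (𝓡 4) x) (κ : ℝ), IsOpen U ∧ connectedComponentIn 𝓑.horizon p ⊆ U ∧ ContMDiffOn (𝓡 4) ((𝓡 4).prod 𝓘(ℝ, Literature.Geometry.Lorentzian.E4)) ((⊤ : ℕ∞) : WithTop ℕ∞) (fun x ↦ (Bundle.TotalSpace.mk' Literature.Geometry.Lorentzian.E4 x (K x) : TangentBundle (𝓡 4) 𝓑.carrier)) U ∧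 (∀ x ∈ U, ∀ v w : TangentSpace (𝓡 4) x, 𝓑.metric.val x (𝓑.metric.leviCivita K x v) w + 𝓑.metric.val x v (𝓑.metric.leviCivita K x w) = 0) ∧ (∀ x ∈ U, VectorField.mlieBracket (𝓡 4) 𝓑.killing K x = 0) ∧ (∀ q ∈ connectedComponentIn 𝓑.horizon p, K q ≠ 0) ∧ (∀ γ : ℝ → 𝓑.carrier, IsMIntegralCurve γ K → γ 0 ∈ connectedComponentIn 𝓑.horizon p → ∀ t, γ t ∈ 𝓑.horizon) ∧ κ ≠ 0 ∧ ∀ q ∈ connectedComponentIn 𝓑.horizon p, 𝓑.metric.leviCivita K q (K q) = κ • K q) → (∀ p ∈ 𝓑.horizon, 𝓑.metric.val p (𝓑.killing p) (𝓑.killing p) = 0) → IsConnected 𝓑.horizon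

/-- item stmt-FinalStateConjecture-18563 · support · rank 9 · open · by planner
sources: ChruscielCostaHeusler2012, arXiv:0905.4179
[support] the same dichotomy for the multi-component type: StaticMultiHorizonConnected → (rotating
multi-horizon case ⇒ connected) → NoMultiHorizonEquilibrium (proved in Sketch.lean,
`noMultiOfCases_proof`); isolates n ≥ 3 rotating equilibria as the genuine residue. [difficulty:
provable-now] -/
@[route_item "route-FinalStateConjecture-HorizonTypeCascade"]
def NoMultiOfCases : Prop :=
  StaticMultiHorizonConnected → (∀ (𝓑 : Literature.Geometry.Lorentzian.StationaryAFBlackHole.{0}) [𝓑.metric.HasLeviCivita], 𝓑.IsIPlusRegular → 𝓑.metric.toPseudoRiemannianMetric.IsRicciFlat → 𝓑.horizon.Nonempty → (∀ p ∈ 𝓑.horizon, ∃ (U : Set 𝓑.carrier) (K : Π x : 𝓑.carrier, TangentSpace (𝓡 4) x) (κ : ℝ), IsOpen U ∧ connectedComponentIn 𝓑.horizon p ⊆ U ∧ ContMDiffOn (𝓡 4) ((𝓡 4).prod 𝓘(ℝ, Literature.Geometry.Lorentzian.E4)) ((⊤ : ℕ∞) : WithTop ℕ∞) (fun x ↦ (Bundle.TotalSpace.mk'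 Literature.Geometry.Lorentzian.E4 x (K x) : TangentBundle (𝓡 4) 𝓑.carrier)) U ∧ (∀ x ∈ U, ∀ v w : TangentSpace (𝓡 4) x, 𝓑.metric.val x (𝓑.metric.leviCivita K x v) w + 𝓑.metric.val x v (𝓑.metric.leviCivita K x w) = 0) ∧ (∀ x ∈ U, VectorField.mlieBracket (𝓡 4) 𝓑.killing K x = 0) ∧ (∀ q ∈ connectedComponentIn 𝓑.horizon p, K q ≠ 0) ∧ (∀ γ : ℝ → 𝓑.carrier, IsMIntegralCurve γ K → γ 0 ∈ connectedComponentIn 𝓑.horizon p → ∀ t, γ t ∈ 𝓑.horizon) ∧ κ ≠ 0 ∧ ∀ q ∈ connectedComponentIn 𝓑.horizon p, 𝓑.metric.leviCivita K q (K q) = κ • K q) → (∃ p ∈ 𝓑.horizon, 𝓑.metric.val p (𝓑.killing p) (𝓑.killing p) ≠ 0) → IsConnected 𝓑.horizon) → NoMultiHorizonEquilibrium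

-- earlier SmoothHawkingRigidity (stmt-FinalStateConjecture-18560, replaced 2026-08-17T03:00:49Z -> stmt-FinalStateConjecture-18788): retired by None — ∀ (𝓑 : Literature.Geometry.Lorentzian.StationaryAFBlackHole.{0}) [𝓑.metric.HasLeviCivita], 𝓑.IsIPlusRegular → 𝓑.metric.toPseudoRiemannianMetric.IsRicciFlat → IsConnected 𝓑.horizon → (∀ p ∈ 𝓑.horizon, ∃ (U : Set 𝓑.carrier) (K : Π x : 𝓑.carrier, Tangent
/-- item stmt-FinalStateConjecture-18788 · support · rank 9 · open · by planner
sources: AlexakisIonescuKlainerman2009, IonescuKlainerman2012, ChruscielCosta2008, arXiv:1501.01587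
[support] leaf 2b-rigidity (GENUINE, filed as support under SmoothNoHair): I⁺-regular vacuum,
connected horizon with a non-degenerate Killing collar, T somewhere non-null on 𝓔⁺ ⇒ a complete
axisymmetric Killing field Y commuting with T (the body of
`StationaryAFBlackHole.IsStationaryAxisymmetric` written out over `Spacetime.IsAxisymmetricKilling`
of Stationary.lean — inlined 2026-08-17 by route-repair so the route no longer imports
AxisymmetricBlackHoleUniqueness → StationaryBlackHoleUniqueness → BlackHoles and their 6 unproved
named facts; reducibly defeq to the rev-0 statement) — Hawking's rigidity without analyticity from
the collar (the collar itself being what AIK local rigidity / Petersen–Rácz supply), the clean form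
of BeltLiouville / ZeroEnergyKerrOrBomb / AnalyticityInvadesErgoregion targets. [difficulty:
open-problem] -/
@[route_item "route-FinalStateConjecture-HorizonTypeCascade"]
def SmoothHawkingRigidity : Prop :=
  ∀ (𝓑 : Literature.Geometry.Lorentzian.StationaryAFBlackHole.{0}) [𝓑.metric.HasLeviCivita], 𝓑.IsIPlusRegular → 𝓑.metric.toPseudoRiemannianMetric.IsRicciFlat → IsConnected 𝓑.horizon → (∀ p ∈ 𝓑.horizon, ∃ (U : Set 𝓑.carrier) (K : Π x : 𝓑.carrier, TangentSpace (𝓡 4) x) (κ : ℝ), IsOpen U ∧ connectedComponentIn 𝓑.horizon p ⊆ U ∧ ContMDiffOn (𝓡 4) ((𝓡 4).prod 𝓘(ℝ, Literature.Geometry.Lorentzian.E4)) ((⊤ : ℕ∞) : WithTop ℕ∞) (fun x ↦ (Bundle.TotalSpace.mk' Literature.Geometry.Lorentzian.E4 x (K x) : TangentBundle (𝓡 4) 𝓑.carrier)) U ∧ (∀ x ∈ U, ∀ v w : TangentSpace (𝓡 4) x, 𝓑.metric.val x (𝓑.metric.leviCivita K x v) w + 𝓑.metric.val x v (𝓑.metric.leviCivita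 K x w) = 0) ∧ (∀ x ∈ U, VectorField.mlieBracket (𝓡 4) 𝓑.killing K x = 0) ∧ (∀ q ∈ connectedComponentIn 𝓑.horizon p, K q ≠ 0) ∧ (∀ γ : ℝ → 𝓑.carrier, IsMIntegralCurve γ K → γ 0 ∈ connectedComponentIn 𝓑.horizon p → ∀ t, γ t ∈ 𝓑.horizon) ∧ κ ≠ 0 ∧ ∀ q ∈ connectedComponentIn 𝓑.horizon p, 𝓑.metric.leviCivita K q (K q) = κ • K q) → (∃ p ∈ 𝓑.horizon, 𝓑.metric.val p (𝓑.killing p) (𝓑.killing p) ≠ 0) → (∀ [𝓑.metric.HasLeviCivita], ∃ Y : Π x : 𝓑.carrier, TangentSpace (𝓡 4) x, 𝓑.toSpacetime.IsAxisymmetricKilling Y ∧ ∀ x, VectorField.mlieBracket (𝓡 4) 𝓑.killing Y x = 0)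

-- earlier NoHairOfCases (stmt-FinalStateConjecture-18562, replaced 2026-08-17T03:01:58Z -> stmt-FinalStateConjecture-18818): retired by None — NonRotatingConnectedIsKerr → SmoothHawkingRigidity → (∀ (𝓑 : Literature.Geometry.Lorentzian.StationaryAFBlackHole.{0}) [𝓑.metric.HasLeviCivita] [Literature.Geometry.Lorentzian.Kerr.Facts] (hF : 𝓑.metric.isOpen_chronologicalFuture 𝓑.timeOrientation) (hP : 𝓑.me
/-- item stmt-FinalStateConjecture-18818 · support · rank 9 · open · by planner
sources: ChruscielCosta2008, ChruscielCostaHeusler2012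
[support] the printed branching theorem one level down (CC08 §7, smooth dress):
NonRotatingConnectedIsKerr → SmoothHawkingRigidity → (CCH12 Thm 3.2 in collar dress: I⁺-regular,
connected horizon with non-degenerate Killing collar, stationary-axisymmetric — written out as the
body of `StationaryAFBlackHole.IsStationaryAxisymmetric` over `Spacetime.IsAxisymmetricKilling`,
inlined 2026-08-17 by route-repair, reducibly defeq to rev 0 — vacuum ⇒ Kerr; the printed theorem
needs only MEAN non-degeneracy; inlined as a hypothesis so no undischarged fact enters the cone: its
in-tree printed form is the named fact `ChruscielCostaHeusler2012_axisymmetricUniqueness`, NOT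
imported) → SmoothNoHair, by cases on `∃ p ∈ 𝓔⁺, g(T,T) ≠ 0` (proved in the opener's Sketch.lean,
`noHairOfCases_proof`; the proof term is unchanged by the inlining). [difficulty: provable-now] -/
@[route_item "route-FinalStateConjecture-HorizonTypeCascade"]
def NoHairOfCases : Prop :=
  NonRotatingConnectedIsKerr → SmoothHawkingRigidity → (∀ (𝓑 : Literature.Geometry.Lorentzian.StationaryAFBlackHole.{0}) [𝓑.metric.HasLeviCivita] [Literature.Geometry.Lorentzian.Kerr.Facts] (hF : 𝓑.metric.isOpen_chronologicalFuture 𝓑.timeOrientation) (hP : 𝓑.metric.isOpen_chronologicalPast 𝓑.timeOrientation), 𝓑.IsIPlusRegular → IsConnected 𝓑.horizon → (∀ p ∈ 𝓑.horizon, ∃ (U : Set 𝓑.carrier) (K : Π x : 𝓑.carrier, TangentSpace (𝓡 4) x) (κ : ℝ), IsOpen U ∧ connectedComponentIn 𝓑.horizon p ⊆ U ∧ ContMDiffOn (𝓡 4) ((𝓡 4).prod 𝓘(ℝ, Literature.Geometry.Lorentzian.E4)) ((⊤ : ℕ∞) : WithTop ℕ∞) (fun x ↦ (Bundle.TotalSpace.mk'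 Literature.Geometry.Lorentzian.E4 x (K x) : TangentBundle (𝓡 4) 𝓑.carrier)) U ∧ (∀ x ∈ U, ∀ v w : TangentSpace (𝓡 4) x, 𝓑.metric.val x (𝓑.metric.leviCivita K x v) w + 𝓑.metric.val x v (𝓑.metric.leviCivita K x w) = 0) ∧ (∀ x ∈ U, VectorField.mlieBracket (𝓡 4) 𝓑.killing K x = 0) ∧ (∀ q ∈ connectedComponentIn 𝓑.horizon p, K q ≠ 0) ∧ (∀ γ : ℝ → 𝓑.carrier, IsMIntegralCurve γ K → γ 0 ∈ connectedComponentIn 𝓑.horizon p → ∀ t, γ t ∈ 𝓑.horizon) ∧ κ ≠ 0 ∧ ∀ q ∈ connectedComponentIn 𝓑.horizon p, 𝓑.metric.leviCivita K q (K q) = κ • K q) → (∀ [𝓑.metric.HasLeviCivita], ∃ Y : Π x : 𝓑.carrier, TangentSpace (𝓡 4) x, 𝓑.toSpacetime.IsAxisymmetricKilling Y ∧ ∀ x, VectorField.mlieBracket (𝓡 4) 𝓑.killing Y x = 0) → 𝓑.metric.toPseudoRiemannianMetric.IsRicciFlat → (∃ (M a : ℝ) (_ : Literature.Geometry.Lorentzian.Kerr.IsSubextremal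 M a) (Φ : Diffeomorph (𝓡 4) 𝓘(ℝ, Literature.Geometry.Lorentzian.E4) (𝓑.docOpens hF hP) (Literature.Geometry.Lorentzian.Kerr.exterior M a) ((⊤ : ℕ∞) : WithTop ℕ∞)), ∀ (y : 𝓑.docOpens hF hP) (v w : EuclideanSpace ℝ (Fin 4)), (Literature.Geometry.Lorentzian.Kerr.smoothMetric M a (Literature.Geometry.Lorentzian.Kerr.rPlus M a)).val (Φ y) (mfderiv (𝓡 4) 𝓘(ℝ, Literature.Geometry.Lorentzian.E4) Φ y v) (mfderiv (𝓡 4) 𝓘(ℝ, Literature.Geometry.Lorentzian.E4) Φ y w) = 𝓑.metric.val y.1 v w)) → SmoothNoHair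

/-- item stmt-FinalStateConjecture-18564 · assembly · rank 1 · open · by planner
sources: DafermosLuk2017, ChruscielCostaHeusler2012
[assembly] GenericStationarySettling → SmoothNoHair → NoMultiHorizonEquilibrium → KerrChartTransfer
→ FinalStateConjecture. -/
@[route_item "route-FinalStateConjecture-HorizonTypeCascade"]
def Assembly : Prop :=
  GenericStationarySettling → SmoothNoHair → NoMultiHorizonEquilibrium → KerrChartTransfer → _root_.FinalStateConjecture

/-! D-0027 §2.1 — DECIDING THEOREM (planner-authored via `route open/edit --closes-file`; by planner-plan-lens3-FinalStateConjecture-cascade-g2-0 2026-08-17T02:45:32Z):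
its hypotheses are this route's items and its conclusion the sub-problem Statement (glue_lint), and it elaborates with this file. -/

/-- The deciding theorem: the dynamical crux delivers, tame-generically, a stationary final state
decomposition whose holes are `I⁺`-regular vacuum black holes with non-degenerate horizon
Killing collars; `NoMultiHorizonEquilibrium` makes each horizon connected (the disconnected type is
empty), `SmoothNoHair` (smooth no-hair from a Killing collar: rigidity + uniqueness) makes each hole a
sub-extremal Kerr exterior, and `KerrChartTransfer` re-adapts the charts into the summit's
`FinalStateDecomposition` with exhaustive, future-oriented charts; tame Christodoulou genericity
is monotone in the property. -/
@[closes "route-FinalStateConjecture-HorizonTypeCascade"] theorem closes (hD : GenericStationarySettling) (hNH : SmoothNoHair)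
    (hNM : NoMultiHorizonEquilibrium) (hT : KerrChartTransfer) : _root_.FinalStateConjecture := by
  intro X _ _ _ _ _ _
  -- tame Christodoulou genericity is monotone in the property
  have mono : ∀ {P Q : Literature.Geometry.Lorentzian.InitialDataSet (𝓡 3) X → Prop},
      (∀ D ∈ Literature.Geometry.Lorentzian.admissibleVacuumData X, P D → Q D) →
      Literature.Geometry.Lorentzian.InitialDataSet.IsTameChristodoulouGeneric
        (Literature.Geometry.Lorentzian.admissibleVacuumData X) P 1 →
      Literature.Geometry.Lorentzian.InitialDataSet.IsTameChristodoulouGeneric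
        (Literature.Geometry.Lorentzian.admissibleVacuumData X) Q 1 := by
    intro P Q hPQ hP d hd
    obtain ⟨e, F, hF, himm, h0, hinj, hadm, hexc⟩ := hP d ⟨hd.1, fun h ↦ hd.2 (hPQ d hd.1 h)⟩
    refine ⟨e, F, hF, himm, h0, hinj, hadm, fun c hc hmem ↦ ?_⟩
    exact hexc c hc ⟨hmem.1, fun h ↦ hmem.2 (hPQ _ hmem.1 h)⟩
  refine mono ?_ (hD X)
  rintro D hDadm ⟨hex, hall⟩
  refine ⟨hex, fun 𝒟 hmax ↦ ?_⟩
  obtain ⟨hscri, O, d, hhole, hnorm, hO, hrays, hexh, hfut⟩ := hall 𝒟 hmax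
  refine ⟨hscri, ?_⟩
  -- every hole is a sub-extremal Kerr exterior (branching on the horizon type is inside:
  -- disconnected horizons are excluded by `hNM`, connected ones are Kerr by `hNH`)
  have hK : ∀ i, ∀ [(d.hole i).metric.HasLeviCivita] [Literature.Geometry.Lorentzian.Kerr.Facts]
      (hF : (d.hole i).metric.isOpen_chronologicalFuture (d.hole i).timeOrientation)
      (hP : (d.hole i).metric.isOpen_chronologicalPast (d.hole i).timeOrientation),
      ∃ (M a : ℝ) (_ : Literature.Geometry.Lorentzian.Kerr.IsSubextremal M a)
        (Φ : Diffeomorph (𝓡 4) 𝓘(ℝ, Literature.Geometry.Lorentzian.E4) ((d.hole i).docOpens hF hP)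
          (Literature.Geometry.Lorentzian.Kerr.exterior M a) ((⊤ : ℕ∞) : WithTop ℕ∞)),
        ∀ (y : (d.hole i).docOpens hF hP) (v w : EuclideanSpace ℝ (Fin 4)),
          (Literature.Geometry.Lorentzian.Kerr.smoothMetric M a (Literature.Geometry.Lorentzian.Kerr.rPlus M a)).val
            (Φ y) (mfderiv (𝓡 4) 𝓘(ℝ, Literature.Geometry.Lorentzian.E4) Φ y v)
            (mfderiv (𝓡 4) 𝓘(ℝ, Literature.Geometry.Lorentzian.E4) Φ y w) = (d.hole i).metric.val y.1 v w := by
    intro i _ _ hF hP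
    obtain ⟨hreg, hvac, hne, hcomp⟩ := hhole i
    -- type split: a disconnected horizon is excluded by `hNM`; the connected type is Kerr by `hNH`
    have hconn : IsConnected (d.hole i).horizon := hNM (d.hole i) hreg hvac hne hcomp
    exact hNH (d.hole i) hF hP hreg hvac hconn hcomp
  obtain ⟨d', hsub, hcharted, hexh', hfut'⟩ := hT 𝒟.toSpacetime O d hhole hK hnorm hexh hfut
  exact ⟨O, d', hsub, hcharted ▸ hO, hrays, hexh', hfut'⟩

end Summit.FinalStateConjecture.FinalStateConjecture.Theses.HorizonTypeCascade
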